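import Summits.NavierStokesRegularity.NavierStokesRegularity.Theorems.SoloRefuteKosovtsov2022

/-!
# C33 `Kosovtsov2022` — the NS generator is not bounded on `L²_u` (part 2 of 2)

Refutes `Literature.Claims.NS.Kosovtsov2022.Step_3` [refuted-substantive] — §3 p.7 l.9–11 of
arXiv:2209.06587v3: for every admissible divergence-free `u` with its Leray pressure `p`, the
generator `A𝒢[u] = 𝒢[F(u)]`, `F(u) = νΔu − (u·∇)u − ∇p`, is claimed bounded on `L²_u`, i.e.
(skeleton `BoundedOn`) `∃ C ≥ 0, ∀ 𝒢 ∈ L¹_u, ‖𝒢[F(u)]‖²_{L²} ≤ C ‖𝒢[u]‖²_{L²}` — and hence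
`Step_2` (§2 p.4 l.1–2, whose second conjunct is `Step_3`; `claim_of_steps` consumes exactly it).

Witness (any `ν`, in particular `ν = 1 ≥ 0`): the compactly supported poloidal field `u` of part 1
(equal to `(x₂, 0, −x₁)` on the unit ball) and the element `𝒢 = ∂₀(·)₁ − ∂₁(·)₀` (vertical
vorticity).  Its representation on `u` vanishes identically, `𝒢[u] = ∂₀∂₁ψ − ∂₁∂₀ψ = 0`, so
`‖𝒢[u]‖ = 0`; its image is `𝒢[F(u)] = ν(∂₀Δu₁ − ∂₁Δu₀) − (∂₀((u·∇)u)₁ − ∂₁((u·∇)u)₀)` (the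
pressure drops out by `∂₀∂₁p = ∂₁∂₀p`), a continuous compactly supported function with value
`−1` at the origin (there `Δu = 0`, `(u·∇)u = −x₁e₀`): `‖𝒢[F(u)]‖² > 0 = C · 0`.  So `A` is not
even single-valued on `L²_u` (a zero element with non-zero image), for every `ν`.

Classification: refuted-substantive.  The load-bearing move of the paper (closability and
boundedness of the Lie/Koopman generator on the `u`-dependent Hilbert space `L²_u`, feeding
Hille–Yosida) fails for the NS operator itself, not at a degenerate instance: `u` is smooth,
compactly supported, divergence free, `ν = 1`.  Repairs tried: (i) `ν > 0` only — the witness is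
`ν`-independent (`not_boundedOn_nsF` is stated for all `ν`); (ii) quotienting `L¹_u` by
`{𝒢 : 𝒢[u] = 0}` — `A` does not descend (this is the failure); (iii) a `u`-independent norm
(e.g. functionals on a fixed Sobolev space) — abandons the `L²_u` mechanism and meets the
finite-radius barrier `Literature.Barriers.NavierStokesRegularity.KoopmanLieSeriesFiniteRadius`.
barrier-candidate: state-dependent seminorms `‖𝒢‖ = ‖𝒢[u]‖` never make a nonlinear generator
single-valued (linear functionals vanishing at `u` need not vanish at `F(u)`).

Also: `not_generationHypotheses` (Proposition 1's hypotheses fail for NS at every `ν`, so the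
typed `Step_6` holds vacuously — `step_6_vacuous`), `claim_of_steps_hypotheses_false`, and the
companion `not_Step_7` (Borel/Whitney inference: `Φ ≡ 0`, `v ≡ 0`, `w = expNegInvGlue` share the
zero jet at `0`, yet `w' ≠ 0 = Φ(w)` on every `[0,T)`).  Credit: the cell typist's kill
candidate (conjunct 1 of `Step_2`, `u = (φ,φ,φ)`) exhibits the same mechanism for the abstract
operator; this file kills the Navier–Stokes instance that the claimed theorem actually uses.

All statements are proved ([folklore]); axioms `propext`, `Classical.choice`, `Quot.sound`.
WHAT THIS IS NOT: not a claim about NS regularity or blow-up; not a claim about any author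
beyond the typed locator.
-/

set_option linter.dupNamespace false

open MeasureTheory Set Filter Metric Module
open scoped ContDiff Topology Laplacian InnerProductSpace

namespace Summit.NavierStokesRegularity.NavierStokesRegularity.Theorems.Kosovtsov2022

open Literature.Claims.NS.Kosovtsov2022 Literature.Analysis.FluidPDE

noncomputable section

/-! ## B'. The field near the origin: `u(x) = (x₂, 0, −x₁)` on the unit ball -/

/-- The unit ball `U`, on which `φ ≡ 1`. [folklore] -/
theorem cut_eq_one {x : Euc 3} (hx : x ∈ ball (0 : Euc 3) 1) : cut x = 1 :=
  bump3.one_of_mem_closedBall (by simpa [bump3] using (mem_ball.1 hx).le)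

/-- `χ = q` on `U`. [folklore] -/
theorem χ_eqOn : EqOn χ q (ball (0 : Euc 3) 1) := fun x hx => by simp [χ, cut_eq_one hx]

/-- Coordinate functions are differentiable with derivative the projection. [folklore] -/
theorem hasFDerivAt_coord (i : Fin 3) (x : Euc 3) :
    HasFDerivAt (fun y : Euc 3 => y i) (EuclideanSpace.proj (𝕜 := ℝ) i : Euc 3 →L[ℝ] ℝ) x :=
  (EuclideanSpace.proj (𝕜 := ℝ) i : Euc 3 →L[ℝ] ℝ).hasFDerivAt

/-- `∂_k q`. [folklore] -/
theorem D_q (k : Fin 3) (x : Euc 3) : D k q x =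
    2⁻¹ * x 2 ^ 2 * (e k) 0 + 2⁻¹ * x 1 ^ 2 * (e k) 1 + x 0 * x 2 * (e k) 2 := by
  have h := (((hasFDerivAt_coord 0 x).mul ((hasFDerivAt_coord 2 x).pow 2)).const_mul 2⁻¹).add
    (((hasFDerivAt_coord 1 x).pow 3).const_mul 6⁻¹)
  have h' : HasFDerivAt q _ x := h
  simp only [D]
  rw [h'.fderiv]
  simp
  ring

/-- `∂_k (x₀x₂)`. [folklore] -/
theorem D_m02 (k : Fin 3) (x : Euc 3) : D k (fun y : Euc 3 => y 0 * y 2) x =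
    x 2 * (e k) 0 + x 0 * (e k) 2 := by
  have h := (hasFDerivAt_coord 0 x).mul (hasFDerivAt_coord 2 x)
  have h' : HasFDerivAt (fun y : Euc 3 => y 0 * y 2) _ x := h
  simp only [D]
  rw [h'.fderiv]
  simp
  ring

/-- `∂_k (x_i²/2)`. [folklore] -/
theorem D_sq (k i : Fin 3) (x : Euc 3) :
    D k (fun y : Euc 3 => 2⁻¹ * y i ^ 2) x = x i * (e k) i := by
  have h := ((hasFDerivAt_coord i x).pow 2).const_mul 2⁻¹
  simp only [D]
  rw [h.fderiv]
  simp

/-- `ψ = x₀x₂` on `U`. [folklore] -/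
theorem ψ_eqOn : EqOn ψ (fun x : Euc 3 => x 0 * x 2) (ball (0 : Euc 3) 1) := fun x hx => by
  rw [show ψ x = D 2 q x from D_congr isOpen_ball χ_eqOn 2 hx, D_q]; simp

/-- `u₀ = x₂` on `U`. [folklore] -/
theorem comps0_eqOn : EqOn (comps 0) (fun x : Euc 3 => x 2) (ball (0 : Euc 3) 1) := fun x hx => by
  rw [show comps 0 x = D 0 (fun y : Euc 3 => y 0 * y 2) x from D_congr isOpen_ball ψ_eqOn 0 hx,
    D_m02]
  simp

/-- `u₁ = 0` on `U`. [folklore] -/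
theorem comps1_eqOn : EqOn (comps 1) (fun _ => 0) (ball (0 : Euc 3) 1) := fun x hx => by
  rw [show comps 1 x = D 1 (fun y : Euc 3 => y 0 * y 2) x from D_congr isOpen_ball ψ_eqOn 1 hx,
    D_m02]
  simp

/-- `u₂ = −x₁` on `U`. [folklore] -/
theorem comps2_eqOn : EqOn (comps 2) (fun x : Euc 3 => -(x 1)) (ball (0 : Euc 3) 1) :=
    fun x hx => by
  have h0 : EqOn (D 0 χ) (fun y : Euc 3 => 2⁻¹ * y 2 ^ 2) (ball (0 : Euc 3) 1) := fun y hy => by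
    rw [D_congr isOpen_ball χ_eqOn 0 hy, D_q]; simp
  have h1 : EqOn (D 1 χ) (fun y : Euc 3 => 2⁻¹ * y 1 ^ 2) (ball (0 : Euc 3) 1) := fun y hy => by
    rw [D_congr isOpen_ball χ_eqOn 1 hy, D_q]; simp
  show -(D 0 (D 0 χ) x + D 1 (D 1 χ) x) = -(x 1)
  rw [D_congr isOpen_ball h0 0 hx, D_congr isOpen_ball h1 1 hx, D_sq, D_sq]; simp

/-- The linear map `x ↦ (x₂, 0, −x₁)`. [folklore] -/
def Lc : Euc 3 →L[ℝ] Euc 3 :=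
  (EuclideanSpace.proj (𝕜 := ℝ) (2 : Fin 3) : Euc 3 →L[ℝ] ℝ).smulRight (e 0) -
    (EuclideanSpace.proj (𝕜 := ℝ) (1 : Fin 3) : Euc 3 →L[ℝ] ℝ).smulRight (e 2)

/-- `Lc x = x₂ e₀ − x₁ e₂`. [folklore] -/
@[simp] theorem Lc_apply (x : Euc 3) : Lc x = (x 2) • e 0 - (x 1) • e 2 := by
  simp [Lc, ContinuousLinearMap.smulRight_apply]

/-- `u = Lc` on `U`. [folklore] -/
theorem uK_eqOn : EqOn uK (fun x => Lc x) (ball (0 : Euc 3) 1) := fun x hx => by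
  ext j
  fin_cases j <;> simp [comps0_eqOn hx, comps1_eqOn hx, comps2_eqOn hx]

/-- `Du = Lc` on `U`. [folklore] -/
theorem fderiv_uK_eqOn {x : Euc 3} (hx : x ∈ ball (0 : Euc 3) 1) : fderiv ℝ uK x = Lc := by
  rw [(uK_eqOn.eventuallyEq_of_mem (isOpen_ball.mem_nhds hx)).fderiv_eq]
  exact Lc.fderiv

/-- `(u·∇)u = −x₁ e₀` on `U`. [folklore] -/
theorem conv_eqOn : EqOn (fun x => fderiv ℝ uK x (uK x)) (fun x : Euc 3 => (-(x 1)) • e 0)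
    (ball (0 : Euc 3) 1) := fun x hx => by
  simp only [fderiv_uK_eqOn hx, uK_eqOn hx, Lc_apply]
  ext j
  fin_cases j <;> simp

/-- `Δu = 0` on `U` (there `u` is linear). [folklore] -/
theorem lap_eqOn : EqOn (fun x => Δ uK x) (fun _ => 0) (ball (0 : Euc 3) 1) := fun x hx => by
  show Δ uK x = 0
  rw [(InnerProductSpace.laplacian_congr_nhds
      (uK_eqOn.eventuallyEq_of_mem (isOpen_ball.mem_nhds hx))).eq_of_nhds,
    laplacian_eq_sum_fderiv_fderiv (EuclideanSpace.basisFun (Fin 3) ℝ) Lc.contDiff x]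
  simp [ContinuousLinearMap.fderiv]

/-! ## D. The element `𝒢 = ∂₀u₁ − ∂₁u₀ ∈ L¹_u` with zero representation and non-zero image -/

/-- The element `𝒢[u] = ∂₀u₁ − ∂₁u₀` (vertical vorticity) of `L¹_u`, as an `LTerm` list.
[folklore] -/
def Lω : List (LTerm 3 3) := [⟨1, 1, 1, ![e 0]⟩, ⟨-1, 1, 0, ![e 1]⟩]

/-- `𝒢[g] = ∂₀ g₁ − ∂₁ g₀`. [folklore] -/
theorem applyL_Lω (g : Euc 3 → Euc 3) (x : Euc 3) :
    applyL Lω g x = D 0 (fun y => g y 1) x - D 1 (fun y => g y 0) x := by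
  simp [applyL, Lω, D, iteratedFDeriv_one_apply, sub_eq_add_neg]

/-- The representation of `𝒢` on the test field vanishes identically: `𝒢[u] = ∂₀∂₁ψ − ∂₁∂₀ψ = 0`.
[folklore] -/
theorem applyL_Lω_uK : applyL Lω uK = fun _ => 0 := by
  funext x
  rw [applyL_Lω, show (fun y => uK y 1) = D 1 ψ from funext fun y => by simp [comps],
    show (fun y => uK y 0) = D 0 ψ from funext fun y => by simp [comps], D_comm ψ_contDiff 0 1]
  ring

/-- Components of `Δu`. [folklore] -/
def lapC (j : Fin 3) : Euc 3 → ℝ := fun x => (Δ uK x) j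

/-- Components of `(u·∇)u`. [folklore] -/
def convC (j : Fin 3) : Euc 3 → ℝ := fun x => (fderiv ℝ uK x (uK x)) j

/-- Components of `F(u) = νΔu − (u·∇)u − ∇p`. [folklore] -/
theorem nsF_apply (ν : ℝ) (x : Euc 3) (j : Fin 3) :
    nsF ν uK pK x j = ν * lapC j x - convC j x - D j pK x := by
  have hg : gradient pK x j = D j pK x := by
    have h1 : ⟪gradient pK x, e j⟫_ℝ = gradient pK x j := by
      simp only [e, EuclideanSpace.inner_single_right, one_mul, RCLike.conj_to_real]
    rw [← h1, gradient, InnerProductSpace.toDual_symm_apply]; rfl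
  simp [nsF, lapC, convC, hg]

/-- `Du` is smooth. [folklore] -/
theorem fderiv_uK_contDiff : ContDiff ℝ ∞ (fderiv ℝ uK) :=
  (contDiff_infty_iff_fderiv.1 uK_contDiff).2

/-- `Δu = Σ_i ∂_i ∂_i u`. [folklore] -/
theorem lap_eq :
    (fun x => Δ uK x) = fun x => ∑ i, fderiv ℝ (fun y => fderiv ℝ uK y (e i)) x (e i) := by
  funext x
  rw [laplacian_eq_sum_fderiv_fderiv (EuclideanSpace.basisFun (Fin 3) ℝ)
    (uK_contDiff.of_le (WithTop.coe_le_coe.2 le_top)) x]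
  simp [e]

/-- `Δu` is smooth. [folklore] -/
theorem lapC_contDiff (j : Fin 3) : ContDiff ℝ ∞ (lapC j) := by
  have h : ContDiff ℝ ∞ (fun x => Δ uK x) := by
    rw [lap_eq]
    exact ContDiff.sum fun i _ =>
      (contDiff_infty_iff_fderiv.1 (fderiv_uK_contDiff.clm_apply contDiff_const)).2.clm_apply
        contDiff_const
  exact contDiff_euclidean.1 h j

/-- `(u·∇)u` is smooth. [folklore] -/
theorem convC_contDiff (j : Fin 3) : ContDiff ℝ ∞ (convC j) :=
  contDiff_euclidean.1 (fderiv_uK_contDiff.clm_apply uK_contDiff) j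

/-- `Δu` vanishes outside the ball. [folklore] -/
theorem lapC_van (j : Fin 3) : Van (lapC j) := fun x hx => by
  have h : Δ uK x = 0 := by
    rw [show Δ uK x = (fun x => Δ uK x) x from rfl, lap_eq]
    exact Finset.sum_eq_zero fun i _ => (uK_van.fderiv_apply (e i)).fderiv_apply (e i) x hx
  simp [lapC, h]

/-- `(u·∇)u` vanishes outside the ball. [folklore] -/
theorem convC_van (j : Fin 3) : Van (convC j) := fun x hx => by simp [convC, uK_van x hx]

/-- The image `𝒢[F(u)] = ν(∂₀Δu₁ − ∂₁Δu₀) − (∂₀((u·∇)u)₁ − ∂₁((u·∇)u)₀)`; the pressure drops out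
(`∂₀∂₁p = ∂₁∂₀p`). [folklore] -/
def Gν (ν : ℝ) (x : Euc 3) : ℝ :=
  ν * (D 0 (lapC 1) x - D 1 (lapC 0) x) - (D 0 (convC 1) x - D 1 (convC 0) x)

/-- `𝒢[F(u)] = Gν`. [folklore] -/
theorem applyL_Lω_nsF (ν : ℝ) : applyL Lω (nsF ν uK pK) = Gν ν := by
  funext x
  rw [applyL_Lω]
  have hF : ∀ j, (fun y => nsF ν uK pK y j) = fun y => ν * lapC j y - convC j y - D j pK y :=
    fun j => funext fun y => nsF_apply ν y j
  have hd : ∀ j k, D k (fun y => ν * lapC j y - convC j y - D j pK y) x =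
      ν * D k (lapC j) x - D k (convC j) x - D k (D j pK) x := by
    intro j k
    have h1 : DifferentiableAt ℝ (lapC j) x := (lapC_contDiff j).differentiable (by simp) x
    have h2 : DifferentiableAt ℝ (convC j) x := (convC_contDiff j).differentiable (by simp) x
    have h3 : DifferentiableAt ℝ (D j pK) x := (contDiff_D pK_contDiff j).differentiable (by simp) x
    have H : HasFDerivAt (fun y => ν * lapC j y - convC j y - D j pK y) _ x :=
      ((h1.hasFDerivAt.const_mul ν).sub h2.hasFDerivAt).sub h3.hasFDerivAt
    show fderiv ℝ (fun y => ν * lapC j y - convC j y - D j pK y) x (e k) = _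
    rw [H.fderiv]
    rfl
  rw [hF 1, hF 0, hd 1 0, hd 0 1, D_comm pK_contDiff 0 1]
  simp only [Gν]
  ring

/-- `Gν` is continuous. [folklore] -/
theorem Gν_continuous (ν : ℝ) : Continuous (Gν ν) := by
  unfold Gν
  exact ((continuous_const.mul ((contDiff_D (lapC_contDiff 1) 0).continuous.sub
    (contDiff_D (lapC_contDiff 0) 1).continuous)).sub
    ((contDiff_D (convC_contDiff 1) 0).continuous.sub (contDiff_D (convC_contDiff 0) 1).continuous))

/-- `Gν` vanishes outside the ball. [folklore] -/
theorem Gν_van (ν : ℝ) : Van (Gν ν) := fun x hx => by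
  simp [Gν, (lapC_van _).D _ x hx, (convC_van _).D _ x hx]

/-- `Gν(0) = −1`: near the origin `Δu = 0` and `(u·∇)u = −x₁e₀`, so `∂₁((u·∇)u)₀(0) = −1`.
[folklore] -/
theorem Gν_zero (ν : ℝ) : Gν ν 0 = -1 := by
  have h0 : (0 : Euc 3) ∈ ball (0 : Euc 3) 1 := mem_ball_self one_pos
  have hl : ∀ j, EqOn (lapC j) (fun _ => 0) (ball (0 : Euc 3) 1) := fun j y hy => by
    simp [lapC, lap_eqOn hy]
  have hc0 : EqOn (convC 0) (fun y : Euc 3 => -(y 1)) (ball (0 : Euc 3) 1) := fun y hy => by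
    simp [convC, conv_eqOn hy]
  have hc1 : EqOn (convC 1) (fun _ => 0) (ball (0 : Euc 3) 1) := fun y hy => by
    simp [convC, conv_eqOn hy]
  have hneg : D 1 (fun y : Euc 3 => -(y 1)) 0 = -1 := by
    have : D 1 (fun y : Euc 3 => -(y 1)) = fun x => -(D 1 (fun y : Euc 3 => y 1) x) := by
      funext x; simp only [D]; rw [fderiv_fun_neg]; rfl
    rw [this, D_coord]; simp
  rw [Gν, D_congr isOpen_ball (hl 1) 0 h0, D_congr isOpen_ball (hl 0) 1 h0,
    D_congr isOpen_ball hc1 0 h0, D_congr isOpen_ball hc0 1 h0, hneg]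
  simp [D_const]

/-- `‖𝒢[F(u)]‖²_{L²} > 0`. [folklore] -/
theorem l2sq_Gν_pos (ν : ℝ) : 0 < l2sq (Gν ν) := by
  unfold l2sq
  refine ((Gν_continuous ν).pow 2).integral_pos_of_hasCompactSupport_nonneg_nonzero ?_
    (fun x => sq_nonneg _) (x := 0) ?_
  · exact (show Van (fun x => Gν ν x ^ 2) from
      fun x hx => by simp [Gν_van ν x hx]).hasCompactSupport
  · rw [Gν_zero]; norm_num

/-! ## E. Verdicts on the typed steps -/

/-- **The NS generator is not bounded on `L²_u` in the sense of §3 p.7 l.9–11** (any `ν`):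
`𝒢 = ∂₀u₁ − ∂₁u₀` has `‖𝒢[u]‖ = 0` but `‖𝒢[F(u)]‖ > 0`, so no constant `C` with
`‖𝒢[F(u)]‖² ≤ C‖𝒢[u]‖²` exists — `A𝒢[u] = 𝒢[F(u)]` is not even single-valued on `L²_u`.
[folklore] -/
theorem not_boundedOn_nsF (ν : ℝ) :
    ¬ Literature.Claims.NS.Kosovtsov2022.BoundedOn uK
      (Literature.Claims.NS.Kosovtsov2022.nsF ν uK pK) := by
  rintro ⟨C, -, hC⟩
  have h := hC Lω
  rw [applyL_Lω_nsF, applyL_Lω_uK] at h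
  have h0 : l2sq (fun _ : Euc 3 => (0 : ℝ)) = 0 := by simp [l2sq]
  rw [h0, mul_zero] at h
  exact absurd h (not_le.2 (l2sq_Gν_pos ν))

/-- **`¬ Step_3`** (§3 p.7 l.9–11: "the generator of the Navier–Stokes equations is bounded …
in the space `L²_u`"): refuted at `ν = 1` by the poloidal test field and its Newtonian pressure.
[folklore] -/
theorem not_Step_3 : ¬ Literature.Claims.NS.Kosovtsov2022.Step_3 := fun h =>
  not_boundedOn_nsF 1 (h 1 zero_le_one uK pK admDF_uK isLerayPressure_pK)

/-- **`¬ Step_2`** (§2 p.4 l.1–2: "A is continuous and therefore bounded and closable on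
`L²_u`"), through its Navier–Stokes instance (second conjunct = `Step_3`). [folklore] -/
theorem not_Step_2 : ¬ Literature.Claims.NS.Kosovtsov2022.Step_2 := fun h => not_Step_3 h.2

/-- **The generation hypotheses of Proposition 1 fail for the NS operator, for every `ν`**
(their boundedness clause is `BoundedOn`). [folklore] -/
theorem not_generationHypotheses (ν : ℝ) :
    ¬ Literature.Claims.NS.Kosovtsov2022.GenerationHypotheses ν := fun h =>
  not_boundedOn_nsF ν (h.2.1 uK pK admDF_uK isLerayPressure_pK)

/-- Consequently `Step_6` (Proposition 1 fed with the generation hypotheses) holds vacuously.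
[folklore] -/
theorem step_6_vacuous : Literature.Claims.NS.Kosovtsov2022.Step_6 := fun ν _ hG =>
  (not_generationHypotheses ν hG).elim

/-- The hypotheses of the skeleton's `claim_of_steps` are jointly unsatisfiable. [folklore] -/
theorem claim_of_steps_hypotheses_false :
    ¬ (Literature.Claims.NS.Kosovtsov2022.Step_1 ∧ Literature.Claims.NS.Kosovtsov2022.Step_2 ∧
      Literature.Claims.NS.Kosovtsov2022.Step_5 ∧ Literature.Claims.NS.Kosovtsov2022.Step_6) :=
  fun h => not_Step_2 h.2.1

/-- **`¬ Step_7`** (companion Borel/Whitney inference): `Φ ≡ 0`, `v ≡ 0` and the flat function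
`w = expNegInvGlue` share the zero jet at `0`, but `w' = Φ(w) = 0` on `[0,T)` would force
`w(T/2) = w(0) = 0 < expNegInvGlue (T/2)`. [folklore] -/
theorem not_Step_7 : ¬ Literature.Claims.NS.Kosovtsov2022.Step_7 := by
  intro h
  have hjet : ∀ k : ℕ, iteratedDeriv k expNegInvGlue 0 = 0 := by
    intro k
    have hEq : ∀ x ∈ Iio (0 : ℝ), iteratedDeriv k expNegInvGlue x = 0 := by
      intro x hx
      have hloc : expNegInvGlue =ᶠ[𝓝 x] fun _ => (0 : ℝ) :=
        (show EqOn expNegInvGlue (fun _ => (0 : ℝ)) (Iio 0) from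
          fun y hy => expNegInvGlue.zero_of_nonpos (le_of_lt hy)).eventuallyEq_of_mem
          (isOpen_Iio.mem_nhds hx)
      rw [iteratedDeriv_eq_iteratedFDeriv, (hloc.iteratedFDeriv ℝ k).eq_of_nhds,
        ← iteratedDeriv_eq_iteratedFDeriv, iteratedDeriv_const]
      simp
    have hcont : ContinuousAt (iteratedDeriv k expNegInvGlue) 0 :=
      (expNegInvGlue.contDiff.continuous_iteratedDeriv k (WithTop.coe_le_coe.2 le_top)).continuousAt
    have hlim : Tendsto (iteratedDeriv k expNegInvGlue) (𝓝[<] 0) (𝓝 0) :=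
      Filter.Tendsto.congr' (eventually_nhdsWithin_of_forall fun x hx => (hEq x hx).symm)
        tendsto_const_nhds
    exact tendsto_nhds_unique (hcont.tendsto.mono_left nhdsWithin_le_nhds) hlim
  obtain ⟨T, hT, hd⟩ := h (fun _ => 0) contDiff_const (fun _ => 0) expNegInvGlue contDiff_const
    expNegInvGlue.contDiff (fun t => by simp) (fun k => by rw [hjet k, iteratedDeriv_const]; simp)
  obtain ⟨c, hc, hcd⟩ := exists_deriv_eq_slope expNegInvGlue (by linarith : (0 : ℝ) < T / 2)
    (expNegInvGlue.contDiff (n := 1)).continuous.continuousOn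
    ((expNegInvGlue.contDiff (n := 1)).differentiable one_ne_zero).differentiableOn
  have h0 : deriv expNegInvGlue c = 0 := by simpa using hd c ⟨hc.1.le, by linarith [hc.2]⟩
  rw [h0, expNegInvGlue.zero, sub_zero] at hcd
  have hpos : 0 < expNegInvGlue (T / 2) / (T / 2 - 0) :=
    div_pos (expNegInvGlue.pos_of_pos (by linarith)) (by linarith)
  linarith

end

end Summit.NavierStokesRegularity.NavierStokesRegularity.Theorems.Kosovtsov2022
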